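import Literature.NumberTheory.EllipticCurves.CubicTwistTransportJZero
import HarnessLib

/-!
# DATA LAYER (R-h) of leaf (L1), crux `UpperOffV0HSYPlus` (stmt-BirchSwinnertonDyer-19804): Kolyvagin's class
# `c(P) ∈ H¹(K, E[n])` does not depend on the admissible subgroup `A` nor on `P` modulo `n·A`

Skeleton of record VARIANT M (`Cruxes/UpperOffV0HSYPlus/Lines/coupled_variantM.lean` 406ca288e244d392); card
v25.  #24 `L1_of_cmFrameClasses_four` uses ONE class function `cA` in both blocks: `c_A(ℓ')` is built at the
level `9pℓ'` (admissible `A = ψ(E₉(K̄)^{Gal(K̄/K[9pℓ'])})`, some transversal `t'`), while k-ty1 #14's pair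
instantiation at the level `9p(ℓℓ')` (see #R-g `…CMDataCoupledFrame`) reads the class through
`A' = ψ(E₉(K̄)^{Gal(K̄/K[9pℓℓ'])}) ⊇ A` and the shared transversal `t` (another transversal changes the
`χ`-component `Σᵢ ρ(tᵢ)(tᵢ • P)` by an element of `n·A`).  The two identifications the rows need:

* `kolyvaginClass_mono` — `A ≤ A'` both admissible ⇒ `c_A(P) = c_{A'}(P)` (McCallum's cocycle
  `g ↦ g(P/n) − P/n − (g−1)P/n` takes the SAME values: the root `(g−1)P/n ∈ A ⊆ A'` is unique in `A'`);
* `kolyvaginClass_eq_of_eq_add_zsmul` — `P' = P + n·a`, `a ∈ A` ⇒ `c(P') = c(P)` (root `P/n + a`;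
  `(g−1)P'/n = (g−1)P/n + (g−1)a` by uniqueness).

Both are VALUE-LEVEL identities of McCallum's cocycle (Gross 1991 (4.4)/(4.6), McCallum 1991 (6), Lemma
4.1 "uniqueness"), no coboundary needed.  And, for the ORIENTATION of #14's one-call (planner D466: block 1
has `W₁ = E_{3p²}` with the cocycle `ρ_A = ρ ∘ ρ` and `W₂ = E_p` with `ρ_A ∘ ρ_A`): `rho_rho_rho_eq`
(`ρ_g³ = 1`: `(g v/v)⁶ = 1`) and `rho_pow_four_coord` (kept in THIS namespace so a later Literature re-home
under `JZero.…` cannot clash — planner D469 (4)) (`ρ_g⁴ = ρ_g` has the `v`-coordinate form), so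
the coupled frame of #R-g `…CMDataCoupledFrame` serves both blocks (`ρ' := ρ_A ∘ ρ_A` satisfies #14's
coordinate hypothesis w.r.t. `v_B`).  HONEST FRAMING: theorems only; nothing about Sel/Ш/FLIP/BSD; no
stub closed; `--supports stmt-BirchSwinnertonDyer-19804 --as helper`.

## References
* B. H. Gross, LMS LNS 153 (1991), §4 (4.4), (4.6). [GrossLMS1991]
* W. G. McCallum, same volume, §4 (6), Lemma 4.1. [McCallumLMS1991]

## Mathlib / tree search
Tree: `kolyvaginClass`, `kolyvaginClass_eq_cls`, `KolyvaginCocycle.oneCocycleClass_congr_val`,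
`coe_cocycle_apply`, `rootIn_eq`, `rootIn_smul_sub_spec`, `IsAdmissible.smul_mem/eq_zero_of_zsmul`
(`HeegnerPointsKolyvaginPrimaryClassesProofs`); only `KolyvaginDescent.kolyvaginClass_congr_point` (literal
equality of points) existed. `lean search 'kolyvaginClass_mono|kolyvaginClass_eq_of'` → nothing before this file.
presearch: n/a (two-line cocycle identities from the printed uniqueness).
-/

set_option linter.dupNamespace false -- Summits modules are `Summit.<Summit>.<Problem>…` by design

noncomputable section

open scoped Classical

namespace Summit.BirchSwinnertonDyer.BirchSwinnertonDyer.Theorems.SylvesterTwoCMData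

open WeierstrassCurve Literature.NumberTheory.EllipticCurves Literature.NumberTheory.EllipticCurves.KolyvaginCocycle

universe u

variable {K : Type u} [Field K] {W : WeierstrassCurve K} {n : ℤ}
  {hdiv : ∀ P : geomPoints W, ∃ Q : geomPoints W, n • Q = P}

/-- **Independence of the admissible subgroup**: for `A ≤ A'` both admissible (`Γ_K`-stable, `[n]`
injective — printed `E(K_m) ⊆ E(K_n)`, `m ∣ n`) and `P` with invariant class for both, Kolyvagin's class
`c(P) ∈ H¹(K, E[n])` is the same (McCallum's cocycle has the same values: the root `(g−1)P/n ∈ A` is the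
unique one in `A'`). [cite: McCallumLMS1991, §4 (6), Lemma 4.1] [cite: GrossLMS1991, §4 (4.4), (4.6)] -/
theorem kolyvaginClass_mono {A A' : AddSubgroup (geomPoints W)}
    (hA : IsAdmissible (Field.absoluteGaloisGroup K) A n)
    (hA' : IsAdmissible (Field.absoluteGaloisGroup K) A' n) (hle : A ≤ A') {P : geomPoints W}
    (hP : P ∈ invPoints (Field.absoluteGaloisGroup K) A n)
    (hP' : P ∈ invPoints (Field.absoluteGaloisGroup K) A' n) :
    kolyvaginClass W n hdiv hA P hP = kolyvaginClass W n hdiv hA' P hP' := by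
  obtain ⟨Q, hQ⟩ := hdiv P
  rw [kolyvaginClass_eq_cls hA hP hQ, kolyvaginClass_eq_cls hA' hP' hQ]
  unfold KolyvaginCocycle.cls
  refine oneCocycleClass_congr_val fun g ↦ ?_
  rw [coe_cocycle_apply, coe_cocycle_apply]
  obtain ⟨hmem, hsmul⟩ := rootIn_smul_sub_spec hP g
  rw [rootIn_eq hA'.eq_zero_of_zsmul (hle hmem) hsmul]

/-- **Independence of `P` modulo `n·A`**: if `P' = P + n • a` with `a ∈ A`, then `c(P') = c(P)` in
`H¹(K, E[n])` (root `P/n + a`; `(g−1)P'/n = (g−1)P/n + (g a − a)` by uniqueness in `A`). In the CM frame: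
another transversal `t'` of `Γ_K/N'` changes `Σᵢ ρ(tᵢ)(tᵢ • P)` by an element of `n·E₉(K̄)^N` when the class
of `P` is `N'`-invariant, so the class `c_χ(n)` is transversal-independent.
[cite: McCallumLMS1991, §4 (6), Lemma 4.1] [cite: GrossLMS1991, §4 (4.4)] -/
theorem kolyvaginClass_eq_of_eq_add_zsmul {A : AddSubgroup (geomPoints W)}
    (hA : IsAdmissible (Field.absoluteGaloisGroup K) A n) {P P' a : geomPoints W} (ha : a ∈ A)
    (hPP' : P' = P + n • a)
    (hP : P ∈ invPoints (Field.absoluteGaloisGroup K) A n)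
    (hP' : P' ∈ invPoints (Field.absoluteGaloisGroup K) A n) :
    kolyvaginClass W n hdiv hA P' hP' = kolyvaginClass W n hdiv hA P hP := by
  obtain ⟨Q, hQ⟩ := hdiv P
  have hQ' : n • (Q + a) = P' := by rw [zsmul_add, hQ, hPP']
  rw [kolyvaginClass_eq_cls hA hP hQ, kolyvaginClass_eq_cls hA hP' hQ']
  unfold KolyvaginCocycle.cls
  refine oneCocycleClass_congr_val fun g ↦ ?_
  rw [coe_cocycle_apply, coe_cocycle_apply]
  -- the root of `(g−1)P'` is `(g−1)P/n + (g a − a)`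
  obtain ⟨hmem, hsmul⟩ := rootIn_smul_sub_spec hP g
  have hroot : rootIn A n (g • P' - P') = rootIn A n (g • P - P) + (g • a - a) := by
    refine rootIn_eq hA.eq_zero_of_zsmul (A.add_mem hmem (A.sub_mem (hA.smul_mem g ha) ha)) ?_
    rw [zsmul_add, hsmul, hPP', smul_add, zsmul_sub, smul_zsmul_comm]
    abel
  rw [hroot, smul_add]
  abel


/-! ### `ρ_g³ = 1` and the `v`-coordinate form of `ρ_g⁴` (orientation of #14's one-call) -/

/-- **`ρ_g ∘ ρ_g ∘ ρ_g = id`** for the CM cocycle `ρ_g = [(g v/v)²]` of a cubic twist (`(g v / v)³ = 1`, so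
`(g v/v)⁶ = 1`). [cite: HuShuYin2019, §1 p. 4 (χ(σ)³ = 1)] [cite: SilvermanAEC2009, X.2.2] -/
theorem rho_rho_rho_eq {k : Type u} [Field k]
    {V : WeierstrassCurve k} {v : AlgebraicClosure k} (hv : v ≠ 0)
    (hv3 : ∀ g : Field.absoluteGaloisGroup k,
      ((show AlgebraicClosure k ≃ₐ[k] AlgebraicClosure k from g) v) ^ 3 = v ^ 3)
    {ρ : Field.absoluteGaloisGroup k → geomPoints V ≃+ geomPoints V}
    (hρ : ∀ (g : Field.absoluteGaloisGroup k) {x y : AlgebraicClosure k}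
        (h : (V.baseChange (AlgebraicClosure k)).toAffine.Nonsingular x y),
        ∃ h', ρ g (Affine.Point.some x y h) =
          Affine.Point.some (((show AlgebraicClosure k ≃ₐ[k] AlgebraicClosure k from g) v / v) ^ 2 * x)
            y h')
    (g : Field.absoluteGaloisGroup k) (P : geomPoints V) : ρ g (ρ g (ρ g P)) = P := by
  have hw : (((show AlgebraicClosure k ≃ₐ[k] AlgebraicClosure k from g) v / v)) ^ 3 = 1 :=
    JZero.div_pow_three_eq_one hv (hv3 g)
  change (V.baseChange (AlgebraicClosure k)).toAffine.Point at P
  rcases P with _ | ⟨x, y, h⟩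
  · change ρ g (ρ g (ρ g 0)) = 0
    rw [map_zero, map_zero, map_zero]
  · obtain ⟨h₁, e₁⟩ := hρ g h
    obtain ⟨h₂, e₂⟩ := hρ g h₁
    obtain ⟨h₃, e₃⟩ := hρ g h₂
    rw [e₁, e₂, e₃]
    refine Affine.Point.some_eq_some_of_eq ?_ rfl
    have : (((show AlgebraicClosure k ≃ₐ[k] AlgebraicClosure k from g) v / v) ^ 2) ^ 3 = 1 := by
      rw [← pow_mul, mul_comm, pow_mul, hw, one_pow]
    linear_combination x * this

/-- **`ρ_g⁴ = ρ_g` in coordinates**: `ρ_g (ρ_g (ρ_g (ρ_g (x, y)))) = ((g v/v)² x, y)` — the coordinate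
hypothesis of k-ty1 #14 for `ρ' := ρ_A ∘ ρ_A` when `ρ_A = ρ ∘ ρ` (block 1 of leaf (L1): `W₁ = E_{3p²}`,
`W₂ = E_p`; `χ_A² = χ_B⁴ = χ_B`). [cite: HuShuYin2019, §1 p. 4] [cite: SilvermanAEC2009, X.2.2] -/
theorem rho_pow_four_coord {k : Type u} [Field k]
    {V : WeierstrassCurve k} {v : AlgebraicClosure k} (hv : v ≠ 0)
    (hv3 : ∀ g : Field.absoluteGaloisGroup k,
      ((show AlgebraicClosure k ≃ₐ[k] AlgebraicClosure k from g) v) ^ 3 = v ^ 3)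
    {ρ : Field.absoluteGaloisGroup k → geomPoints V ≃+ geomPoints V}
    (hρ : ∀ (g : Field.absoluteGaloisGroup k) {x y : AlgebraicClosure k}
        (h : (V.baseChange (AlgebraicClosure k)).toAffine.Nonsingular x y),
        ∃ h', ρ g (Affine.Point.some x y h) =
          Affine.Point.some (((show AlgebraicClosure k ≃ₐ[k] AlgebraicClosure k from g) v / v) ^ 2 * x)
            y h')
    (g : Field.absoluteGaloisGroup k) {x y : AlgebraicClosure k}
    (h : (V.baseChange (AlgebraicClosure k)).toAffine.Nonsingular x y) :
    ∃ h', (fun g ↦ ((ρ g).trans (ρ g)).trans ((ρ g).trans (ρ g))) g (Affine.Point.some x y h) =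
      Affine.Point.some (((show AlgebraicClosure k ≃ₐ[k] AlgebraicClosure k from g) v / v) ^ 2 * x) y h' := by
  obtain ⟨h₁, e₁⟩ := hρ g h
  refine ⟨h₁, ?_⟩
  change ρ g (ρ g (ρ g (ρ g (Affine.Point.some x y h)))) = _
  rw [rho_rho_rho_eq hv hv3 hρ g, e₁]

end Summit.BirchSwinnertonDyer.BirchSwinnertonDyer.Theorems.SylvesterTwoCMData

end
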